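import Literature.Topology.FourManifolds.TorusCoordinates
import Literature.Topology.FourManifolds.KnotFraming
import Mathlib.Analysis.SpecialFunctions.SmoothTransition
import HarnessLib

/-!
# Disc extension, layer 0'': flat stepQ functions and the periodic stepQ

Auxiliary file of helper `helper_sliceGluing_discExtension` (apex leaf DX: extension of the
torus angular coordinate over the torus disc), line `Sketch`, crux `SblfDescent.RungOne`.

(Crux item stmt-SmoothPoincare4-18531; skeleton `Cruxes/RungOne/Lines/Sketch.lean`.)

* `stepQ` — a smooth stepQ function equal to `0` on `(-∞, 1/4]` and to `1` on `[3/4, ∞)` (from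
  `Real.smoothTransition`), with values in `[0, 1]`;
* `perStep t = ⌊t⌋ + stepQ (stepQ (fract t))` — a smooth map `ℝ → ℝ` with
  `perStep (t + 1) = perStep t + 1`, constant `= n` near each integer `n` (used to flatten loops
  of diffeomorphisms near the base point and to reparametrise the angle of the torus disc).

Everything is folklore calculus.
-/

set_option linter.dupNamespace false

noncomputable section

open scoped Manifold ContDiff Topology Real
open Set Function Metric Literature.Topology.FourManifolds

namespace Summit.SmoothPoincare4.SmoothPoincare4.Cruxes.RungOne.Sketch

namespace DiscExt

/-! ### Flat stepQ functions -/

/-- **The stepQ function** `stepQ t = smoothTransition (2t - 1/2)`: smooth, `0` for `t ≤ 1/4`,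
`1` for `t ≥ 3/4`, with values in `[0, 1]`. [folklore] -/
def stepQ (t : ℝ) : ℝ := Real.smoothTransition (2 * t - 1 / 2)

/-- `stepQ` is smooth. [folklore] -/
theorem contDiff_stepQ : ContDiff ℝ ∞ stepQ :=
  Real.smoothTransition.contDiff.comp ((contDiff_const.mul contDiff_id).sub contDiff_const)

/-- `stepQ` is continuous. [folklore] -/
theorem continuous_stepQ : Continuous stepQ := contDiff_stepQ.continuous

/-- `stepQ t = 0` for `t ≤ 1/4`. [folklore] -/
theorem stepQ_of_le {t : ℝ} (h : t ≤ 1 / 4) : stepQ t = 0 :=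
  Real.smoothTransition.zero_of_nonpos (by linarith)

/-- `stepQ t = 1` for `t ≥ 3/4`. [folklore] -/
theorem stepQ_of_ge {t : ℝ} (h : 3 / 4 ≤ t) : stepQ t = 1 :=
  Real.smoothTransition.one_of_one_le (by linarith)

/-- `stepQ 0 = 0`. [folklore] -/
@[simp] theorem stepQ_zero : stepQ 0 = 0 := stepQ_of_le (by norm_num)

/-- `stepQ 1 = 1`. [folklore] -/
@[simp] theorem stepQ_one : stepQ 1 = 1 := stepQ_of_ge (by norm_num)

/-- `0 ≤ stepQ t`. [folklore] -/
theorem stepQ_nonneg (t : ℝ) : 0 ≤ stepQ t := Real.smoothTransition.nonneg _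

/-- `stepQ t ≤ 1`. [folklore] -/
theorem stepQ_le_one (t : ℝ) : stepQ t ≤ 1 := Real.smoothTransition.le_one _

/-- `stepQ (stepQ t) = 0` for `t ≤ 1/4`. [folklore] -/
theorem stepQ_stepQ_of_le {t : ℝ} (h : t ≤ 1 / 4) : stepQ (stepQ t) = 0 := by
  rw [stepQ_of_le h, stepQ_zero]

/-- `stepQ (stepQ t) = 1` for `t ≥ 3/4`. [folklore] -/
theorem stepQ_stepQ_of_ge {t : ℝ} (h : 3 / 4 ≤ t) : stepQ (stepQ t) = 1 := by
  rw [stepQ_of_ge h, stepQ_one]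

/-- **The periodic stepQ** `perStep t = ⌊t⌋ + stepQ (stepQ (fract t))`. [folklore] -/
def perStep (t : ℝ) : ℝ := ⌊t⌋ + stepQ (stepQ (Int.fract t))

/-- `perStep (t + 1) = perStep t + 1`. [folklore] -/
theorem perStep_add_one (t : ℝ) : perStep (t + 1) = perStep t + 1 := by
  rw [perStep, perStep, Int.floor_add_one, Int.fract_add_one]
  push_cast
  ring

/-- On the open unit interval about `n`, `perStep t = n + stepQ (stepQ (t - n))`. [folklore] -/
theorem perStep_of_mem_Ico {t : ℝ} {n : ℤ} (h : t ∈ Ico (n : ℝ) (n + 1)) :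
    perStep t = n + stepQ (stepQ (t - n)) := by
  have hfl : ⌊t⌋ = n := Int.floor_eq_iff.2 ⟨h.1, h.2⟩
  rw [perStep, ← Int.self_sub_floor, hfl]

/-- **`perStep` is constant `= n` on `(n - 1/4, n + 1/4)`.** [folklore] -/
theorem perStep_of_abs_lt {t : ℝ} {n : ℤ} (h : |t - n| < 1 / 4) : perStep t = n := by
  rcases lt_or_ge t n with ht | ht
  · have hmem : t ∈ Ico ((n - 1 : ℤ) : ℝ) ((n - 1 : ℤ) + 1) := by
      constructor
      · push_cast; linarith [(abs_lt.1 h).1]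
      · push_cast; linarith
    rw [perStep_of_mem_Ico hmem, stepQ_stepQ_of_ge]
    · push_cast; ring
    · push_cast; linarith [(abs_lt.1 h).1]
  · have hmem : t ∈ Ico (n : ℝ) (n + 1) := ⟨ht, by linarith [(abs_lt.1 h).2]⟩
    rw [perStep_of_mem_Ico hmem, stepQ_stepQ_of_le, add_zero]
    linarith [(abs_lt.1 h).2]

/-- `perStep n = n` at integers. [folklore] -/
theorem perStep_intCast (n : ℤ) : perStep n = n :=
  perStep_of_abs_lt (by simp)

/-- `perStep 0 = 0`. [folklore] -/
@[simp] theorem perStep_zero : perStep 0 = 0 := by exact_mod_cast perStep_intCast 0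

/-- **`perStep` is smooth.** [folklore] -/
theorem contDiff_perStep : ContDiff ℝ ∞ perStep := by
  refine contDiff_iff_contDiffAt.2 fun t₀ ↦ ?_
  by_cases hint : |t₀ - round t₀| < 1 / 4
  · -- constant near `t₀`
    have hev : perStep =ᶠ[𝓝 t₀] fun _ ↦ (round t₀ : ℝ) := by
      have ho : IsOpen {t : ℝ | |t - round t₀| < 1 / 4} :=
        isOpen_lt (continuous_abs.comp (continuous_id.sub continuous_const)) continuous_const
      filter_upwards [ho.mem_nhds hint] with t ht
      exact perStep_of_abs_lt ht
    exact contDiffAt_const.congr_of_eventuallyEq hev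
  · -- `t₀` is at distance `≥ 1/4` from `ℤ`: use the formula on `(n, n + 1)`, `n = ⌊t₀⌋`
    set n := ⌊t₀⌋ with hn
    have h1 : (n : ℝ) ≤ t₀ := Int.floor_le t₀
    have h2 : t₀ < n + 1 := Int.lt_floor_add_one t₀
    have hlo : (n : ℝ) < t₀ := by
      refine lt_of_le_of_ne h1 fun he ↦ hint ?_
      have : round t₀ = n := by rw [← he, round_intCast]
      rw [this, ← he]; simp
    have hev : perStep =ᶠ[𝓝 t₀] fun t ↦ (n : ℝ) + stepQ (stepQ (t - n)) := by
      filter_upwards [Ioo_mem_nhds hlo h2] with t ht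
      exact perStep_of_mem_Ico ⟨ht.1.le, ht.2⟩
    refine ContDiffAt.congr_of_eventuallyEq ?_ hev
    exact contDiffAt_const.add ((contDiff_stepQ.comp contDiff_stepQ).contDiffAt.comp t₀
      (contDiffAt_id.sub contDiffAt_const))

/-- `perStep` is continuous. [folklore] -/
theorem continuous_perStep : Continuous perStep := contDiff_perStep.continuous

/-- `circlePt (perStep t) = circlePt (stepQ (stepQ (fract t)))`. [folklore] -/
theorem circlePt_perStep (t : ℝ) : circlePt (perStep t) = circlePt (stepQ (stepQ (Int.fract t))) := by
  rw [show perStep t = stepQ (stepQ (Int.fract t)) + (⌊t⌋ : ℤ) by rw [perStep]; ring]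
  exact circlePt_add_int _ _

/-- Near an integer, `stepQ (fract t) ∈ {0, 1}`. [folklore] -/
theorem stepQ_fract_of_abs_lt {t : ℝ} {n : ℤ} (h : |t - n| < 1 / 4) :
    stepQ (Int.fract t) = 0 ∨ stepQ (Int.fract t) = 1 := by
  rcases lt_or_ge t n with ht | ht
  · right
    have hfl : ⌊t⌋ = n - 1 := Int.floor_eq_iff.2 ⟨by push_cast; linarith [(abs_lt.1 h).1], by push_cast; linarith⟩
    have : Int.fract t = t - (n - 1) := by rw [← Int.self_sub_floor, hfl]; push_cast; ring
    rw [this]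
    exact stepQ_of_ge (by linarith [(abs_lt.1 h).1])
  · left
    have hfl : ⌊t⌋ = n := Int.floor_eq_iff.2 ⟨ht, by linarith [(abs_lt.1 h).2]⟩
    have : Int.fract t = t - n := by rw [← Int.self_sub_floor, hfl]
    rw [this]
    exact stepQ_of_le (by linarith [(abs_lt.1 h).2])

end DiscExt

end Summit.SmoothPoincare4.SmoothPoincare4.Cruxes.RungOne.Sketch

end
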